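import Summits.Ventures.PercRepro.S1CoreLPRowsAll
import Summits.Ventures.PercRepro.S1CellNineTen
import Summits.Ventures.PercRepro.RankLevelSetLocalSparse
import Summits.Ventures.PercRepro.RankLevelSetPlaneSix

/-!
# PercRepro — END 9: `C-025` AT LEVEL `4` FOR EVERY `p ≥ 9` (p2, gen 29; SUBCLAIM-S1 §6.10 (xviii))

The five cells `(9, 5) … (9, 9)` of the row-`9` frame (`S1RowNineFrame.c025_four_nine_of_cells`) are theorems: an
`e`-free core is simple with lines of at most `3` points (night-1's `two_le_eRk_of_two_le_ncard_of_free`,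
`ncard_add_one_le_two_pow_of_eRk_le`), so `rls_nine_four_of_<n>_all` applies; with `(9, 10)` (`c025_core_nine_ten`)
the frame gives **`c025_four_nine : ∀ M p, 9 ≤ p → ThmN.RLS M p 4`** — the window of record of the `q = 4` row
reads `7 ≤ p ≤ 8` once this module is of record.

* `pairs_of_free`, `lines_of_free`; `cellNine_five` … `cellNine_nine`; **`c025_four_nine`**.
Axioms: standard.
-/

open scoped Matroid

namespace PercRepro

namespace S1

open Set

variable {α : Type}

/-- An `e`-free core has all pairs of rank `2`. -/
theorem pairs_of_free (M : Matroid α) [M.Finite]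
    (hfree : ∀ e ∈ M.E, ∃ A ⊆ M.E \ {e}, e ∉ M.closure A ∧ e ∉ M.closure ((M.E \ {e}) \ A)) :
    ∀ e ∈ M.E, ∀ f ∈ M.E, e ≠ f → M.eRk {e, f} = 2 := by
  intro e he f hf hef
  have h2 : (2 : ℕ∞) ≤ M.eRk {e, f} :=
    ThmN.two_le_eRk_of_two_le_ncard_of_free M hfree (pair_subset he hf) (by rw [ncard_pair hef])
  have h3 : M.eRk {e, f} ≤ 2 := by
    have := M.eRk_le_encard {e, f}
    rwa [encard_pair hef] at this
  exact le_antisymm h3 h2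

/-- An `e`-free core has lines of at most `3` points. -/
theorem lines_of_free (M : Matroid α) [M.Finite]
    (hfree : ∀ e ∈ M.E, ∃ A ⊆ M.E \ {e}, e ∉ M.closure A ∧ e ∉ M.closure ((M.E \ {e}) \ A)) :
    ∀ L ⊆ M.E, M.eRk L = 2 → L.ncard ≤ 3 := by
  intro L hL hr
  have := ThmN.ncard_add_one_le_two_pow_of_eRk_le M (ThmN.not_isLoop_of_free M hfree) hfree 2 L hL hr.le
  omega

/-- **THE CELL `(9, 5)`**. -/
theorem cellNine_five : CellNine (α := α) 5 := fun M _ hR hn hfree =>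
  rls_nine_four_of_fourteen_all M hR hn (pairs_of_free M hfree) (lines_of_free M hfree)

/-- **THE CELL `(9, 6)`**. -/
theorem cellNine_six : CellNine (α := α) 6 := fun M _ hR hn hfree =>
  rls_nine_four_of_fifteen_all M hR hn (pairs_of_free M hfree) (lines_of_free M hfree)

/-- **THE CELL `(9, 7)`**. -/
theorem cellNine_seven : CellNine (α := α) 7 := fun M _ hR hn hfree =>
  rls_nine_four_of_sixteen_all M hR hn (pairs_of_free M hfree) (lines_of_free M hfree)

/-- **THE CELL `(9, 8)`**. -/
theorem cellNine_eight : CellNine (α := α) 8 := fun M _ hR hn hfree =>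
  rls_nine_four_of_seventeen_all M hR hn (pairs_of_free M hfree) (lines_of_free M hfree)

/-- **THE CELL `(9, 9)`**. -/
theorem cellNine_nine : CellNine (α := α) 9 := fun M _ hR hn hfree =>
  rls_nine_four_of_eighteen_all M hR hn (pairs_of_free M hfree) (lines_of_free M hfree)

/-- **END 9**: `C-025` at level `4` for every finite matroid and every `p ≥ 9`. -/
theorem c025_four_nine (M : Matroid α) [M.Finite] (p : ℕ) (hp : 9 ≤ p) : ThmN.RLS M p 4 :=
  c025_four_nine_of_cells cellNine_five cellNine_six cellNine_seven cellNine_eight cellNine_nine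
    (fun M _ hR hn hfree => c025_core_nine_ten M hR hn hfree) M p hp

end S1

end PercRepro
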